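import Mathlib
import Summits.Ventures.PercRepro2.TwoHullMasterEdgeInduction

/-!
# Edge induction for the RIGID cube-cover conjecture (blind cell PercRepro2, night-4 g41,
2026-08-29; proofs/NIGHT4-G41.md §2)

The rigid twin of TwoHullMasterEdgeInduction.lean: the same loop trick and the same induction over
the edge set for `CubeBlockRigid` / `CubeCoverRigid` (the edge pair `(E_R(h), E_B(h))` of `h` in
place of its hull pair).  In a graph of loops the edge pair of `h` is `(∅, ∅)` (`edgePair_loops`),
so the full cube is a rigid block (`cubeBlockRigid_loops`); `RefinementRigid`,
`cubeCoverRigid_of_refinement`, and **`cubeCoverRigidConjecture_of_refinement`** — the rigid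
conjecture (hence row 2′SW-ALL on every graph, `swAll_all_of_cubeCoverRigidConjecture`) from a
local refinement principle for any class of rigid blocks containing the full cube of every graph of
loops and closed under refinement along a new edge.

* `edgePair_loops`, `cubeBlockRigid_loops`;
* `RefinementRigid`, `cubeCoverRigid_of_refinement`;
* **`cubeCoverRigidConjecture_of_refinement`**.
-/

namespace Summit.Ventures.PercRepro2

namespace Blocks

open Hull LocRows

open scoped Classical

variable {V : Type*} {E : Type*} [DecidableEq E]

/-! ## §1 The edge pair of `h` in a graph of loops -/

omit [DecidableEq E] in
/-- In a graph of loops at `l` the edge pair of `h ≠ l` is `(∅, ∅)`: no edge lies within `{h}`. -/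
lemma edgePair_loops {ends : E → Sym2 V} {l h : V} (hl : ∀ e, ends e = s(l, l)) (hlh : l ≠ h)
    (ω : Config E) : edgePair ends ω h = (∅, ∅) := by
  have key : ∀ ζ : Config E, redEdges ends ζ h = ∅ := by
    intro ζ
    ext e
    simp only [redEdges, Set.mem_setOf_eq, Set.mem_empty_iff_false, iff_false, not_and]
    intro _ he
    rw [cluster_loops hl] at he
    obtain ⟨x, hx, y, hy, hxy⟩ := he
    rw [Set.mem_singleton_iff] at hx hy
    subst hx; subst hy
    rw [hl e, Sym2.eq_iff] at hxy
    exact hlh (by rcases hxy with ⟨h1, _⟩ | ⟨h1, _⟩ <;> exact h1)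
  simp only [edgePair, blueEdges, key]

omit [DecidableEq E] in
/-- **The edgeless graph is one full rigid cube.** -/
theorem cubeBlockRigid_loops {ends : E → Sym2 V} {l h : V} (hl : ∀ e, ends e = s(l, l))
    (hlh : l ≠ h) : CubeBlockRigid ends l h (id : (E → Bool) → Config E) where
  inj := Function.injective_id
  mem := fun ε => by
    simp only [hull, cluster_loops hl, id, Set.union_self, Set.mem_singleton_iff]
    exact hlh.symm
  l_mono := fun ε ε' _ => by
    simp only [hullPair_loops hl]
    exact ⟨subset_rfl, subset_rfl⟩
  h_anti := fun ε ε' _ => by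
    simp only [edgePair_loops hl hlh]
    exact ⟨subset_rfl, subset_rfl⟩
  mirror := Or.inl fun ε => by simp only [hullPair_loops hl, Prod.swap]

/-! ## §2 Rigid refinements -/

/-- **A rigid refinement of a block along a new edge**: as `Refinement`, with rigid blocks. -/
structure RefinementRigid (ends ends' : E → Sym2 V) (l h : V) {ι : Type*}
    (pt : (ι → Bool) → Config E) {γ : Type*} {ι' : γ → Type*}
    (pt' : ∀ c, (ι' c → Bool) → Config E) : Prop where
  /-- Every new block is a rigid monotone cube block of the new graph. -/
  block : ∀ c, CubeBlockRigid ends' l h (pt' c)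
  /-- Every point of a new block is a point of the old block. -/
  sub : ∀ c ε', ∃ ε, pt' c ε' = pt ε
  /-- Every surviving point of the old block lies in a new block. -/
  cover : ∀ ε, h ∉ hull ends' (pt ε) l → ∃ c ε', pt' c ε' = pt ε
  /-- Two new blocks sharing a point are the same block. -/
  disj : ∀ c c' ε' ε'', pt' c ε' = pt' c' ε'' → c = c'

variable {β : Type*} {ι : β → Type*} {pt : ∀ b, (ι b → Bool) → Config E}
  {γ : β → Type*} {ι' : ∀ b, γ b → Type*} {pt' : ∀ b c, (ι' b c → Bool) → Config E}

/-- **Refining every block of a rigid cube cover along a new edge gives a rigid cube cover of the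
new graph.** -/
theorem cubeCoverRigid_of_refinement {ends : E → Sym2 V} {l h : V} {e₀ : E} {x : V}
    (h₀ : ends e₀ = s(x, x)) (p : Sym2 V) (hc : CubeCoverRigid ends l h pt)
    (href : ∀ b, RefinementRigid ends (Function.update ends e₀ p) l h (pt b) (pt' b)) :
    CubeCoverRigid (Function.update ends e₀ p) l h (refinedPt pt') where
  block := fun bc => (href bc.1).block bc.2
  cover := fun ζ hζ => by
    have hζ' : h ∉ hull ends ζ l := fun hh => hζ (hull_update_loop_subset h₀ p ζ l hh)
    obtain ⟨b, ε, rfl⟩ := hc.cover ζ hζ'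
    obtain ⟨c, ε', hε'⟩ := (href b).cover ε hζ
    exact ⟨⟨b, c⟩, ε', hε'⟩
  disj := fun bc bc' ε ε' heq => by
    obtain ⟨b, c⟩ := bc
    obtain ⟨b', c'⟩ := bc'
    obtain ⟨δ, hδ⟩ := (href b).sub c ε
    obtain ⟨δ', hδ'⟩ := (href b').sub c' ε'
    simp only [refinedPt] at heq
    have hb : b = b' := hc.disj b b' δ δ' (by rw [← hδ, ← hδ', heq])
    subst hb
    have hcc : c = c' := (href b).disj c c' ε ε' heq
    subst hcc
    rfl

/-! ## §3 The induction -/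

/-- **The rigid cube-cover conjecture from a local refinement principle**: as
`cubeCoverConjecture_of_refinement`, with rigid blocks and rigid refinements. -/
theorem cubeCoverRigidConjecture_of_refinement
    (Good : ∀ {V E : Type} [Fintype V] [DecidableEq V] [Fintype E] [DecidableEq E],
      (E → Sym2 V) → V → V → ∀ {ι : Type}, ((ι → Bool) → Config E) → Prop)
    (hbase : ∀ {V E : Type} [Fintype V] [DecidableEq V] [Fintype E] [DecidableEq E]
      (ends : E → Sym2 V) (l h : V), l ≠ h → (∀ e, ends e = s(l, l)) →
      Good ends l h (id : (E → Bool) → Config E))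
    (hstep : ∀ {V E : Type} [Fintype V] [DecidableEq V] [Fintype E] [DecidableEq E]
      (ends : E → Sym2 V) (l h : V), l ≠ h → ∀ (e₀ : E) (p : Sym2 V), ends e₀ = s(l, l) →
      ∀ {ι : Type} [Fintype ι] (pt : (ι → Bool) → Config E), CubeBlockRigid ends l h pt →
        Good ends l h pt →
        ∃ (γ : Type) (_ : Fintype γ) (ι' : γ → Type) (_ : ∀ c, Fintype (ι' c))
          (pt' : ∀ c, (ι' c → Bool) → Config E),
          RefinementRigid ends (Function.update ends e₀ p) l h pt pt' ∧
            ∀ c, Good (Function.update ends e₀ p) l h (pt' c)) :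
    CubeCoverRigidConjecture := by
  intro V E _ _ _ _ ends l h hlh
  -- the statement proved by induction on the edge set `S`
  suffices key : ∀ S : Finset E,
      ∃ (β : Type) (_ : Fintype β) (ι : β → Type) (_ : ∀ b, Fintype (ι b))
        (pt : ∀ b, (ι b → Bool) → Config E),
        CubeCoverRigid (loopify ends l S) l h pt ∧ ∀ b, Good (loopify ends l S) l h (pt b) by
    obtain ⟨β, hβ, ι, hι, pt, hc, _⟩ := key Finset.univ
    rw [loopify_univ] at hc
    exact ⟨β, hβ, ι, hι, pt, hc⟩
  intro S
  induction S using Finset.induction_on with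
  | empty =>
    refine ⟨Unit, inferInstance, fun _ => E, fun _ => inferInstance, fun _ => id, ?_, ?_⟩
    · refine ⟨fun _ => cubeBlockRigid_loops (loopify_empty ends l) hlh, fun ζ _ => ⟨(), ζ, rfl⟩,
        fun b b' _ _ _ => Subsingleton.elim b b'⟩
    · intro _
      exact hbase _ l h hlh (loopify_empty ends l)
  | insert e₀ S h₀ ih =>
    obtain ⟨β, hβ, ι, hι, pt, hc, hgood⟩ := ih
    have hloop : loopify ends l S e₀ = s(l, l) := loopify_of_notMem ends l S e₀ h₀
    choose γ hγ ι' hι' pt' href hgood' using fun b =>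
      hstep (loopify ends l S) l h hlh e₀ (ends e₀) hloop (pt b) (hc.block b) (hgood b)
    rw [loopify_insert ends l S e₀ h₀]
    refine ⟨Σ b, γ b, inferInstance, fun bc => ι' bc.1 bc.2, fun bc => hι' bc.1 bc.2,
      refinedPt pt', cubeCoverRigid_of_refinement hloop (ends e₀) hc href, fun bc => hgood' bc.1 bc.2⟩

end Blocks

end Summit.Ventures.PercRepro2
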